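import Summits.ResolutionOfSingularities.ResolutionOfSingularities.Theorems.PurelyInseparableDim4InScopeWinCertFastF
import HarnessLib
import HarnessLib.Audit.Tags

/-!
# Purely inseparable fourfolds — IN-SCOPE WIN CERTIFICATES: fast F-keyed checker with NORMALISED children (`iwinCertHBLFN`)
# [OURS · counted 0 · a certificate format for OUR frame v4, not about resolution]

Census cell «res-dim4-pi» (D-0157 DOOR 2), width seat `res-dim4-p-10` (g4).  The StepKit term lists are never combined:
`transAll` multiplies the number of terms (a 32-monomial state translated in two cubed variables becomes 512 terms with
repeated exponents) and `StepKit.equivB` then compares coefficients by scanning both lists for every term — quadratic in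
that length.  On the unit leaves with three exponents `≥ 3` this alone exhausts the kernel («excessive memory» on ONE row,
seat memo `pub/res-dim4/res-dim4-p-10/UNIT-CLASS-TEXT.md` §6).  Here the child's term list is NORMALISED before it is
compared — like exponents merged (`insertT` / `normalizeL`), zero coefficients dropped (`compactL`), the presented polynomial
unchanged (`evalT_compactL`) — and the checker `iwinCertHBLFN` is p-10's `iwinCertHBLF` (p706889: Hasse–Taylor test + F-keyed
citation) with that normalisation; soundness **`inScopeStateWins_of_iwinCertHBLFN`** is proved row by row exactly as
p-13's `inScopeStateWins_of_irowOKF` (the in-scope attractor reads `F` only, `FlatAbsorb.inScopeStateWins_congr`).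
Acceptance: p-14's model `scopeLossCert` passes.

Riders: `K`-rational replies over the finite `K` of the certificate (NOT ∀K); a statement about OUR frame-v4 game; nothing
here proves F4-C(2,2) or resolution of singularities in dimension ≥ 4 / characteristic `p`; counted 0; AI kernel work,
weaker than expert review. bears_on: LADDER-RESOLUTION:D157-DOOR2 (res-dim4-pi · F4-C instrument · certificate format).
Supports stmt-ResolutionOfSingularities-16155 (helper).
-/

set_option linter.dupNamespace false

noncomputable section

namespace Summit.ResolutionOfSingularities.ResolutionOfSingularities.Theorems.PIDim4

namespace InScopeWinCert

open MvPolynomial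
open Literature.AlgebraicGeometry.Resolution
open StepKit WinCertSound ScopeBlind

/-! ## 1. Normalising a term list -/

section Normalise

variable {n : ℕ} {R : Type*} [CommRing R]

/-- Insert a term, merging it with the first term of the same exponent. [folklore] -/
def insertT (t : (Fin n → ℕ) × R) : Terms n R → Terms n R
  | [] => [t]
  | u :: L => if u.1 = t.1 then (u.1, u.2 + t.2) :: L else u :: insertT t L

/-- `insertT` adds the term's monomial. [folklore] -/
theorem evalT_insertT (t : (Fin n → ℕ) × R) (L : Terms n R) :
    evalT (insertT t L) = monomial (expo t.1) t.2 + evalT L := by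
  induction L with
  | nil => simp [insertT]
  | cons u L ih =>
    by_cases h : u.1 = t.1
    · simp only [insertT, if_pos h, evalT_cons]
      rw [map_add, h]
      abel
    · simp only [insertT, if_neg h, evalT_cons, ih]
      abel

/-- Merge like exponents. [folklore] -/
def normalizeL : Terms n R → Terms n R
  | [] => []
  | t :: L => insertT t (normalizeL L)

/-- Normalising does not change the presented polynomial. [folklore] -/
theorem evalT_normalizeL (L : Terms n R) : evalT (normalizeL L) = evalT L := by
  induction L with
  | nil => rfl
  | cons t L ih => rw [normalizeL, evalT_insertT, ih, evalT_cons]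

variable [DecidableEq R]

/-- Dropping zero coefficients does not change the presented polynomial. [folklore] -/
theorem evalT_filter_ne_zero (L : Terms n R) : evalT (L.filter fun t => t.2 ≠ 0) = evalT L := by
  induction L with
  | nil => rfl
  | cons t L ih =>
    by_cases h : t.2 ≠ 0
    · rw [List.filter_cons_of_pos (by simpa using h), evalT_cons, evalT_cons, ih]
    · rw [List.filter_cons_of_neg (by simpa using h), evalT_cons, ih]
      push Not at h
      rw [h, map_zero, zero_add]

/-- **Compact normal form** of a term list: like exponents merged, zero coefficients dropped. [folklore] -/
def compactL (L : Terms n R) : Terms n R := (normalizeL L).filter fun t => t.2 ≠ 0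

/-- The compact form presents the same polynomial. [folklore] -/
theorem evalT_compactL (L : Terms n R) : evalT (compactL L) = evalT L := by
  rw [compactL, evalT_filter_ne_zero, evalT_normalizeL]

end Normalise

/-! ## 2. The checker with normalised children -/

variable {K : Type} [Field K] [DecidableEq K] [Fintype K]

/-- B's reply `(j, b)` is harmless (fast, F-keyed, normalised): rejected by the Hasse–Taylor test, or kills `F`, or its
polynomial — in compact normal form — is certified later. [folklore] -/
def ireplyHOKFN (q : ℕ) (rest : ICert K) (s : SData 4 K) (S : Finset (Fin 4)) (j : Fin 4) (b : Fin 4 → K) : Bool :=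
  !(equiHB q S j b s) ||
    (StepKit.equivB (compactL (stepD q S j b s).L) [] ||
      ichildInF rest ⟨compactL (stepD q S j b s).L, (stepD q S j b s).r, (stepD q S j b s).exc⟩)

/-- The row check: BLIND, or origin not `q`-fold, or a permissible centre all of whose `K`-rational replies are harmless.
[folklore] -/
def irowHOKFN (q : ℕ) (rest : ICert K) (row : IRow K) : Bool :=
  blindOK q row || !(permB q Finset.univ row.1.L) ||
    (permB q row.2.1 row.1.L &&
      decide (∀ j ∈ row.2.1, ∀ b : Fin 4 → K, b j = 0 → ireplyHOKFN q rest row.1 row.2.1 j b = true))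

/-- **The fast F-keyed checker with normalised children and external leaves.** [folklore] -/
def iwinCertHBLFN (q : ℕ) (L : List (SData 4 K)) : ICert K → Bool
  | [] => true
  | row :: rest => irowHOKFN q (rest ++ leafRows L) row && iwinCertHBLFN q L rest

/-! ## 3. Soundness -/

/-- **SOUNDNESS of one row.** [folklore] -/
theorem inScopeStateWins_of_irowHOKFN {q : ℕ} {rest : ICert K}
    (hrest : ∀ r ∈ rest, InScopeStateWins q r.1.toState) {row : IRow K}
    (h : irowHOKFN q rest row = true) : InScopeStateWins q row.1.toState := by
  unfold irowHOKFN at h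
  rw [Bool.or_eq_true, Bool.or_eq_true] at h
  rcases h with (hblind | hterm) | hmove
  · unfold blindOK at hblind
    obtain ⟨s, S, oβ⟩ := row
    cases oβ with
    | none => exact absurd hblind Bool.false_ne_true
    | some β => exact inScopeStateWins_of_not_inCoordinateScope (not_inCoordinateScope_of_check hblind)
  · have hperm : permB q Finset.univ row.1.L = false := by
      rw [Bool.not_eq_true'] at hterm; exact hterm
    exact inScopeStateWins_of_no_permissible (no_permissible_of_not_permB hperm)
  · rw [Bool.and_eq_true, decide_eq_true_eq] at hmove
    obtain ⟨hS, hall⟩ := hmove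
    refine inScopeStateWins_move row.2.1 ((isPermissibleCentre_iff q row.2.1 row.1.L).mpr hS) ?_
    rintro s' ⟨j, b, hj, hbj, heq, hne, rfl⟩
    have h := hall j hj b hbj
    unfold ireplyHOKFN at h
    rw [Bool.or_eq_true, Bool.or_eq_true] at h
    have hF : (CentreBlowup.step q row.2.1 j b row.1.toState).F = evalT (compactL (stepD q row.2.1 j b row.1).L) := by
      rw [step_toState, SData.toState_F, evalT_compactL]
    rcases h with h1 | h2 | h3
    · rw [Bool.not_eq_true'] at h1
      exact absurd (equiHB_of_isEquimultiplePoint heq) (by rw [h1]; exact Bool.false_ne_true)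
    · exact absurd (by rw [hF, (evalT_eq_iff_equivB _ _).mpr h2, evalT_nil]) hne
    · obtain ⟨r, hr, hrc⟩ := exists_of_ichildInF h3
      refine FlatAbsorb.inScopeStateWins_congr (hrest r hr) _ ?_
      rw [hF, ← hrc, SData.toState_F]

/-- **SOUNDNESS OF THE NORMALISED FAST F-KEYED CHECKER WITH EXTERNAL LEAVES.** [folklore] -/
theorem inScopeStateWins_of_iwinCertHBLFN {q : ℕ} {L : List (SData 4 K)}
    (hL : ∀ s ∈ L, InScopeStateWins q s.toState) :
    ∀ {T : ICert K}, iwinCertHBLFN q L T = true → ∀ row ∈ T, InScopeStateWins q row.1.toState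
  | [], _ => fun row hrow => absurd hrow List.not_mem_nil
  | row :: rest, h => by
    unfold iwinCertHBLFN at h
    rw [Bool.and_eq_true] at h
    have hrest := inScopeStateWins_of_iwinCertHBLFN hL h.2
    have hrestL : ∀ r ∈ rest ++ leafRows L, InScopeStateWins q r.1.toState := by
      intro r hr
      rcases List.mem_append.mp hr with h1 | h2
      · exact hrest r h1
      · obtain ⟨s, hs, rfl⟩ := mem_leafRows h2
        exact hL s hs
    intro r hr
    rcases List.mem_cons.mp hr with rfl | hr'
    · exact inScopeStateWins_of_irowHOKFN hrestL h.1
    · exact hrest r hr'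

/-- The ROOT of a checked certificate is in-scope escapable. [folklore] -/
theorem inScopeStateWins_head_of_iwinCertHBLFN {q : ℕ} {L : List (SData 4 K)}
    (hL : ∀ s ∈ L, InScopeStateWins q s.toState) {row : IRow K} {rest : ICert K}
    (h : iwinCertHBLFN q L (row :: rest) = true) : InScopeStateWins q row.1.toState :=
  inScopeStateWins_of_iwinCertHBLFN hL h row List.mem_cons_self

/-! ## 4. Model -/

/-- p-14's PR-12u model certificate `scopeLossCert` (over `𝔽₂`) passes the normalised checker with no leaves.
[OURS · ‖ K] [folklore] -/
theorem iwinCertHBLFN_scopeLossCert : iwinCertHBLFN 2 ([] : List (SData 4 (ZMod 2))) scopeLossCert = true := by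
  decide +kernel

end InScopeWinCert

end Summit.ResolutionOfSingularities.ResolutionOfSingularities.Theorems.PIDim4

end
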